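import Literature.MathematicalPhysics.QuantumFieldTheory.Balaban1983to89.B1RTSemigroup
import Literature.MathematicalPhysics.QuantumFieldTheory.Balaban1983to89.B1Sect3Statements

/-!
# `Balaban1983to89.B1Eq365Proof` — T. Bałaban, *(Higgs)₂,₃ quantum fields in a finite volume. I. A lower bound*,
Commun. Math. Phys. **85** (1982) 603–626 [Balaban1982Higgs1]: the generating functions **(3.35)** p. 618 (`E_k`) and
**(3.64)** p. 624 (`E′`) TYPED over the tree's renormalization-transformation operators (`B1RT.rtOp` (2.4), `B1RT.blockKernel`
(2.5)/(2.10), `B1RTSemigroup.qAvg` (2.7)), and **(3.65)** p. 624, `E′ = ½⟨B, Δ^{(k+1),L^{k+1}ε}B⟩ + E_{k+1}`, DERIVED — as the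
text says — from *"the law of composition of the renormalization transformations (2.14)"* (`B1RTSemigroup.display214`,
kernel-checked by r14) *"and the convention (3.34)"* (`Q_{k+1} = Q ∘ Q_k`): the hypothesis-shaped row of record
`B1Sect3Statements.Eq365` is DISCHARGED for the typed `E′`, `E_{k+1}`

statement-level skeleton of published theorems with citation tags; proofs where landed; nothing here is a claim about the Yang–Mills mass gap

PDF held: `paper:balaban1982-cmp85-higgs23-i` (journal page = PDF page + 602); (3.34)–(3.36) p. 618 and (3.62)–(3.65) p. 624
READ AS IMAGES on the x2 renders `run/shared/lean/pub/pub-balaban/b2b-balaban-ref1/pages/1982-cmp85-higgs23-I/…-p016-x2.png`,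
`…-p022-x2.png`; (2.14) p. 609 `…-p007-x2.png`.

CITATION HEADER (lean-in-tree rule).  WHAT IS REPRODUCED — SKELETON rows **B1.Eq3.35** (reader r12
`lit-balaban-r12/ROWS-B1-part2.md`: «DEF generating function E_k(e′,λ′,eA^{(k),ε},φ) = −log[Gaussian normalisations·
∫dA′_{k−1}…∫dA′₀ T^ε_{a_k,L^k,eA^{(k),ε}+e′ΣA′^{(j),ε}}[exp(−½⟨φ′,(−Δ^ε_{…})φ′⟩ − Σ_xε^d𝒫(e′,λ′,φ(x)) − E)]]; absent ·
integral expression»), **B1.Eq3.64** («explicit E′(e′,λ′,B,ψ) = ½⟨B,Δ^{(k+1),L^{k+1}ε}B⟩ − log[Π_{j=0}^k(Gaussian)∫dA′_j…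
T^{L^kε}_{a,L,…}[T^ε_{a_k,L^k,…}[…]]]; absent · integral expression») and **B1.Eq3.65** («COMPOSITION E′ = ½⟨B,ΔB⟩ + E_{k+1}
(by the law of composition of RTs (2.14) and (3.34)); typed p239973 · shapes» — `B1Sect3Statements.Eq365`, a hypothesis
shape).  Verbatim, p. 618 [PDF 16]: *"Let us introduce at first the function E_k(e′, λ′, eA^{(k),ε}, φ) = −log[(a(L^kε)^{d−2}/2π)
^{(d/2)|T₁^{(k)}|} ∫dA′_{k−1} exp(−½⟨A′_{k−1}, (C^{(k−1),L^{k−1}ε})⁻¹A′_{k−1}⟩)·…·(a(Lε)^{d−2}/2π)^{(d/2)|T₁^{(1)}|} ∫dA′₀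
exp(−½⟨A′₀, (C^{(0),ε})⁻¹A′₀⟩)·T^ε_{a_k,L^k,eA^{(k),ε}+e′Σ_{j=0}^{k−1}A′^{(j),ε}}[exp(−½⟨φ′, (−Δ^ε_{eA^{(k),ε}+e′ΣA′^{(j),ε}})φ′⟩
− Σ_{x∈T_ε} ε^d𝒫(e′, λ′, φ(x)) − E)]], 𝒫(e′, λ′, φ) = λ′|φ|⁴ + ½δm²(e′, λ′)|φ|². (3.35)"*; p. 624 [PDF 22]: *"E′(e′, λ′, B, ψ)
= ½⟨B, Δ^{(k+1),L^{k+1}ε}B⟩ − log[Π_{j=0}^{k} (a(L^{j+1}ε)^{d−2}/2π)^{(d/2)|T₁^{(j+1)}|} ∫dA′_j exp(−½⟨A′_j,(C^{(j),L^jε})⁻¹A′_j⟩)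
·T^{L^kε}_{a,L,eB^{(k+1)ε}+e′A′^{(k)ε}}[T^ε_{a_k,L^k,eB^{(k+1)ε}+e′Σ_{j=0}^{k}A′^{(j)ε}}[exp[−½⟨φ′,(−Δ^ε_{eB^{(k+1)ε}+e′ΣA′^{(j)ε}})φ′⟩
− Σ_{x∈T_ε} ε^d𝒫(e′,λ′,φ′(x)) − E]]]]. (3.64)  Taking into account the law of composition of the renormalization
transformations (2.14) and the convention (3.34) we obtain the following equality E′(e′, λ′, B, ψ) = ½⟨B, Δ^{(k+1),L^{k+1}ε}B⟩
+ E_{k+1}(e′, λ′, eB^{(k+1)ε}, ψ). (3.65)"*; p. 609 [PDF 7]: *"T^{L^kε}_{a,L,A}T^ε_{a_k,L^k,A} = T^ε_{a_{k+1},L^{k+1},A}. (2.14)"*.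

THE TYPING (schematic where the paper's objects are built elsewhere, CONCRETE in the RT structure that (3.65) uses):
`V` ↤ `ℝ^N` (a finite-dimensional real inner-product space with its Borel Lebesgue measure, as in `B1RT`); `X` ↤ the fine
sites `T_ε` (field `φ′ : X → V`, integrated with the product Lebesgue measure inside `rtOp`); `Z` ↤ the coarse sites
`T^{(k+1)}`, `Z × B` ↤ the middle sites `T^{(k)}` presented as blocks of `T^{(k+1)}` (`B1RTSemigroup`'s model of (1.17)/(2.2));
`(ΩA, νA)` ↤ ALL the fluctuation gauge fields `A′_k, …, A′_0` with the weighted measure `Π_j (prefactor_j)·exp(−½⟨A′_j,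
(C^{(j)})⁻¹A′_j⟩)dA′_j` of (3.35)/(3.64) (any measure on any measurable space — only its rôle as an outer average enters (3.65));
the couplings `(e′, λ′)` are explicit arguments; the kernels `t e′ a` ↤ the RT kernels (2.5)/(2.10) `t_{·,·,𝒜}` whose transports
depend on the gauge field `𝒜 = eB^{(k+1)} + e′ΣA′^{(j)}` (hence on `e′` and on the point `a ∈ ΩA`), `ρ e′ λ′ a` ↤ the density
`exp[−½⟨φ′,(−Δ^ε_𝒜)φ′⟩ − Σ_x ε^d𝒫(e′,λ′,φ′(x)) − E]`; `quadB` ↤ `⟨B, Δ^{(k+1),L^{k+1}ε}B⟩`.  The convention (3.34) is what makes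
the block averages of the two transformations in (3.64) compose to `Q_{k+1}(𝒜)` — in `B1RTSemigroup.Display214` this is the
composed block-average map `qAvg w u ∘ m`.

WHAT THIS FILE PROVES (0 `sorry`, standard axioms; two `def`s with bodies = the typed rows, no `Prop` fact):
* `genFn335` — (3.35) (and its instance `E_{k+1}` at level `k+1`): `E(e′,λ′;ψ) = −log ∫_{ΩA} (T_{t(e′,a)}[ρ(e′,λ′,a)])(ψ) dνA(a)`;
  `genFn364` — (3.64): `E′(e′,λ′;ψ) = ½quadB − log ∫_{ΩA} (T_{t₁(e′,a)}[T_{t₂(e′,a)}[ρ(e′,λ′,a)]])(ψ) dνA(a)`; unfolding lemmas;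
* **`eq365_of_comp`** — if for every `e′, λ′` and every fluctuation configuration `a` the two transformations compose,
  `T_{t₁}[T_{t₂}[ρ]] = T_{t}[ρ]` (as functions of the block field), then `B1Sect3Statements.Eq365 E′ E_{k+1} quadB` holds for
  `E′ = genFn364 …`, `E_{k+1} = genFn335 … t …`;
* **`eq365_rt`** — **(3.65) DERIVED from (2.14)**: with the B1RT block kernels `t₁ = blockKernel α (qAvg w u)` (the one-step
  `T^{L^kε}_{a,L,𝒜}`, (2.5)–(2.7)), `t₂ = blockKernel β m` (the k-th order `T^ε_{a_k,L^k,𝒜}`, (2.10)–(2.11)), and `t = blockKernel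
  (compPrec α β w |B|) (qAvg w u ∘ m)` (the (k+1)-st order transformation, precision (2.12)–(2.13) = `a_{k+1}(L^{k+1}ε)^{d−2}` for
  the printed data by `B1RT.prec_comp`, block average `Q_{k+1} = Q ∘ Q_k` = (2.2)/(3.34)), `Eq365` HOLDS whenever `α, β > 0`, the
  block-average maps are measurable and the densities integrable — by `B1RTSemigroup.display214` under the `νA`-integral.
  Downstream: `B1Step363Proof.step363_of_eq365` turns this into (3.63) ⇔ (3.36)_{k+1} (`Step363`).
HONEST SCOPE.  The densities, transports and the measure `νA` are data (rows B1.Eq2.1/2.7/2.11, (2.30), (3.29) build them);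
the `−log` is the real logarithm of a real integral exactly as printed (p. 624: *"the formula is not well defined because
the expression in the exponent is … not necessarily positive … It is not interesting enough to make these remarks more
precise"* — no positivity is claimed or needed for (3.65), which is an identity of the arguments of `log`).
Unit `lit-balaban-p14` gen 3 (Phase-2 proof seat p14, literature-prover-lit-balaban-p14-g3-0), HOME
`run/shared/lean/pub/lit-balaban/` (seat log `lit-balaban-p14/STATUS.md`).
-/

open scoped BigOperators ENNReal
open _root_.MeasureTheory _root_.Real

namespace Literature.MathematicalPhysics.QuantumFieldTheory.Balaban1983to89.B1Eq365Proof

open Literature.MathematicalPhysics.QuantumFieldTheory.Balaban1983to89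
open B1RT B1RTSemigroup B1Sect3Statements

/-! ## §1 The generating functions (3.35) and (3.64), typed over `B1RT.rtOp` -/

section GenFn

variable {V : Type*} [NormedAddCommGroup V] [InnerProductSpace ℝ V] [FiniteDimensional ℝ V]
  [MeasurableSpace V] [BorelSpace V]
variable {X W Y : Type*} [Fintype X] [Fintype W]
variable {ΩA : Type*} [MeasurableSpace ΩA]

/-- **(3.35)** p. 618 [PDF 16] (verbatim in the module docstring): the generating function
`E_k(e′, λ′, eA^{(k),ε}, φ) = −log[(Gaussian normalisations)∫dA′_{k−1}…∫dA′₀ T^ε_{a_k,L^k,𝒜}[exp(−½⟨φ′,(−Δ^ε_𝒜)φ′⟩ −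
Σ_x ε^d𝒫(e′,λ′,φ′(x)) − E)]]`, `𝒜 = eA^{(k),ε} + e′Σ_{j<k}A′^{(j),ε}` — TYPED as minus the logarithm of the `νA`-average
(`νA` ↤ the weighted fluctuation-field measure, all `A′_j` together) of the renormalization transformation `B1RT.rtOp` (2.4)
with the `(e′, a)`-dependent kernel `t e′ a` (↤ (2.10) `t_{a_k,L^k,𝒜}`) applied to the `(e′, λ′, a)`-dependent density
`ρ e′ λ′ a` of the fine field, evaluated at the block field `ψ` (↤ the argument `φ` of `E_k`).  The same shape one level up
is `E_{k+1}(e′, λ′, eB^{(k+1)ε}, ψ)` of (3.65). [cite: Balaban1982Higgs1, (3.35) p.618] -/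
noncomputable def genFn335 (νA : Measure ΩA) (t : ℝ → ΩA → (Y → V) → (X → V) → ℝ)
    (ρ : ℝ → ℝ → ΩA → (X → V) → ℝ) (ψ : Y → V) (e' l' : ℝ) : ℝ :=
  -Real.log (∫ a, rtOp (t e' a) (ρ e' l' a) ψ ∂νA)

/-- Unfolding lemma (definitional). [cite: Balaban1982Higgs1, (3.35) p.618] -/
theorem genFn335_eq (νA : Measure ΩA) (t : ℝ → ΩA → (Y → V) → (X → V) → ℝ)
    (ρ : ℝ → ℝ → ΩA → (X → V) → ℝ) (ψ : Y → V) (e' l' : ℝ) :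
    genFn335 νA t ρ ψ e' l' = -Real.log (∫ a, rtOp (t e' a) (ρ e' l' a) ψ ∂νA) := rfl

/-- **(3.64)** p. 624 [PDF 22] (verbatim in the module docstring): `E′(e′, λ′, B, ψ) = ½⟨B, Δ^{(k+1),L^{k+1}ε}B⟩ −
log[Π_{j=0}^{k}(Gaussian)∫dA′_j … T^{L^kε}_{a,L,𝒜}[T^ε_{a_k,L^k,𝒜}[exp[…]]]]` — TYPED as `½quadB` minus the logarithm of
the `νA`-average of the COMPOSITION of two renormalization transformations (outer kernel `t₁ e′ a` ↤ the one-step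
`t^{L^kε}_{a,L,𝒜}` (2.5)–(2.6) from the middle sites `W` to the block field on `Y`, inner kernel `t₂ e′ a` ↤ the k-th order
`t^ε_{a_k,L^k,𝒜}` (2.10) from the fine sites `X` to `W`) applied to the density `ρ e′ λ′ a`, at `ψ`.
[cite: Balaban1982Higgs1, (3.64) p.624] -/
noncomputable def genFn364 (quadB : ℝ) (νA : Measure ΩA) (t₁ : ℝ → ΩA → (Y → V) → (W → V) → ℝ)
    (t₂ : ℝ → ΩA → (W → V) → (X → V) → ℝ) (ρ : ℝ → ℝ → ΩA → (X → V) → ℝ) (ψ : Y → V) (e' l' : ℝ) : ℝ :=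
  1 / 2 * quadB - Real.log (∫ a, rtOp (t₁ e' a) (rtOp (t₂ e' a) (ρ e' l' a)) ψ ∂νA)

/-- Unfolding lemma (definitional). [cite: Balaban1982Higgs1, (3.64) p.624] -/
theorem genFn364_eq (quadB : ℝ) (νA : Measure ΩA) (t₁ : ℝ → ΩA → (Y → V) → (W → V) → ℝ)
    (t₂ : ℝ → ΩA → (W → V) → (X → V) → ℝ) (ρ : ℝ → ℝ → ΩA → (X → V) → ℝ) (ψ : Y → V) (e' l' : ℝ) :
    genFn364 quadB νA t₁ t₂ ρ ψ e' l'
      = 1 / 2 * quadB - Real.log (∫ a, rtOp (t₁ e' a) (rtOp (t₂ e' a) (ρ e' l' a)) ψ ∂νA) := rfl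

/-- **(3.65) from a composition law**, abstract kernels: if for all couplings `e′, λ′` and every fluctuation configuration
`a` the two transformations of (3.64) compose into the one of (3.35) at level `k + 1` — `T_{t₁}[T_{t₂}[ρ]] = T_{t}[ρ]` as
functions of the block field (this is (2.14) together with the convention (3.34)) — then `E′ = ½⟨B, ΔB⟩ + E_{k+1}`, i.e.
the row of record `B1Sect3Statements.Eq365 E′ E_{k+1} quadB` HOLDS for `E′ = genFn364 …`, `E_{k+1} = genFn335 … t …`.
[cite: Balaban1982Higgs1, (3.65) p.624] -/
theorem eq365_of_comp (quadB : ℝ) (νA : Measure ΩA) (t₁ : ℝ → ΩA → (Y → V) → (W → V) → ℝ)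
    (t₂ : ℝ → ΩA → (W → V) → (X → V) → ℝ) (t : ℝ → ΩA → (Y → V) → (X → V) → ℝ)
    (ρ : ℝ → ℝ → ΩA → (X → V) → ℝ) (ψ : Y → V)
    (hcomp : ∀ e' l' a, rtOp (t₁ e' a) (rtOp (t₂ e' a) (ρ e' l' a)) = rtOp (t e' a) (ρ e' l' a)) :
    Eq365 (genFn364 quadB νA t₁ t₂ ρ ψ) (genFn335 νA t ρ ψ) quadB := by
  intro e' l'
  rw [genFn364_eq, genFn335_eq, sub_eq_add_neg]
  congr 3
  refine integral_congr_ae (Filter.Eventually.of_forall fun a => ?_)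
  show rtOp (t₁ e' a) (rtOp (t₂ e' a) (ρ e' l' a)) ψ = rtOp (t e' a) (ρ e' l' a) ψ
  rw [hcomp e' l' a]

end GenFn

/-! ## §2 (3.65) derived from (2.14) = `B1RTSemigroup.display214` -/

section FromDisplay214

variable {V : Type*} [NormedAddCommGroup V] [InnerProductSpace ℝ V] [FiniteDimensional ℝ V]
  [MeasurableSpace V] [BorelSpace V]
variable {Z B X : Type*} [Fintype Z] [Fintype B] [Fintype X]
variable {ΩA : Type*} [MeasurableSpace ΩA]

/-- **(3.65) p. 624 DERIVED from the composition law (2.14) p. 609** — *"Taking into account the law of composition of the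
renormalization transformations (2.14) and the convention (3.34) we obtain the following equality E′(e′, λ′, B, ψ) =
½⟨B, Δ^{(k+1),L^{k+1}ε}B⟩ + E_{k+1}(e′, λ′, eB^{(k+1)ε}, ψ). (3.65)"*: for the B1RT kernels of (3.64) — outer one-step
kernel `blockKernel α (qAvg w (u e′ a))` ((2.5)–(2.7): precision `α` ↤ `a(L^{k+1}ε)^{d−2}`, block average `Q(𝒜)` with the
isometric transports `u e′ a` of the field `𝒜 = eB^{(k+1)} + e′A′^{(k)}`), inner k-th order kernel `blockKernel β (m e′ a)`
((2.10)–(2.11): `β` ↤ `a_k(L^kε)^{d−2}`, `Q_k(𝒜)` ↦ any measurable map `m e′ a`) — and the (k+1)-st order kernel of `E_{k+1}`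
((3.35) at k+1): precision `compPrec α β w |B|` ((2.12)–(2.13); = `a_{k+1}(L^{k+1}ε)^{d−2}` for the printed data, `B1RT.prec_comp`)
and block average `Q_{k+1}(𝒜) = Q(𝒜) ∘ Q_k(𝒜)` ((2.2) with the convention (3.34)), `Eq365 E′ E_{k+1} ⟨B,ΔB⟩` HOLDS — for
ALL integrable densities `ρ e′ λ′ a`, every measure `νA` on the fluctuation fields and every block field `ψ`.
[cite: Balaban1982Higgs1, (3.65) p.624] -/
theorem eq365_rt (quadB : ℝ) (νA : Measure ΩA) {α β : ℝ} (hα : 0 < α) (hβ : 0 < β) (w : ℝ)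
    (u : ℝ → ΩA → Z × B → (V ≃ₗᵢ[ℝ] V)) {m : ℝ → ΩA → (X → V) → Z × B → V} (hm : ∀ e' a, Measurable (m e' a))
    {ρ : ℝ → ℝ → ΩA → (X → V) → ℝ} (hρ : ∀ e' l' a, Integrable (ρ e' l' a)) (ψ : Z → V) :
    Eq365
      (genFn364 quadB νA (fun e' a => blockKernel α (qAvg w (u e' a))) (fun e' a => blockKernel β (m e' a)) ρ ψ)
      (genFn335 νA
        (fun e' a => blockKernel (compPrec α β w (Fintype.card B)) (fun φ => qAvg w (u e' a) (m e' a φ))) ρ ψ)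
      quadB :=
  eq365_of_comp quadB νA _ _ _ ρ ψ fun e' l' a => display214 (V := V) hα hβ w (u e' a) (hm e' a) (hρ e' l' a)

/-- The same with both sides displayed (unfolded): `½⟨B,ΔB⟩ − log ∫ T^{L^kε}_{a,L,𝒜}[T^ε_{a_k,L^k,𝒜}[ρ]](ψ) dνA =
½⟨B,ΔB⟩ + (−log ∫ T^ε_{a_{k+1},L^{k+1},𝒜}[ρ](ψ) dνA)`. [cite: Balaban1982Higgs1, (3.65) p.624] -/
theorem eq365_rt_display (quadB : ℝ) (νA : Measure ΩA) {α β : ℝ} (hα : 0 < α) (hβ : 0 < β) (w : ℝ)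
    (u : ℝ → ΩA → Z × B → (V ≃ₗᵢ[ℝ] V)) {m : ℝ → ΩA → (X → V) → Z × B → V} (hm : ∀ e' a, Measurable (m e' a))
    {ρ : ℝ → ℝ → ΩA → (X → V) → ℝ} (hρ : ∀ e' l' a, Integrable (ρ e' l' a)) (ψ : Z → V) (e' l' : ℝ) :
    1 / 2 * quadB - Real.log (∫ a, rtOp (blockKernel α (qAvg w (u e' a)))
        (rtOp (blockKernel β (m e' a)) (ρ e' l' a)) ψ ∂νA)
      = 1 / 2 * quadB + -Real.log (∫ a, rtOp (blockKernel (compPrec α β w (Fintype.card B))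
        (fun φ => qAvg w (u e' a) (m e' a φ))) (ρ e' l' a) ψ ∂νA) :=
  eq365_rt quadB νA hα hβ w u hm hρ ψ e' l'

end FromDisplay214

end Literature.MathematicalPhysics.QuantumFieldTheory.Balaban1983to89.B1Eq365Proof
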